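import Summits.AtomisticToContinuum.FouriersLaw.Theorems.BondHeatUncertaintySubdiffusiveBondHeatThoulessBudgetLadder

/-!
# The Ohm-free surplus of `ThoulessBudget` is a kinetic-corrector budget (T₁ ⟸ KCB)

Decomposition node `decomp-a2c-lens-1 / g53` (grading lens), below the N_F ladder of record
`9120 (S) ⟹ ThoulessBudget (TB) ⟹ LateBudget (LB) ⟺_(K) BoundedResponse (11071) ⟹ FouriersLaw`
(`…Theorems.SubdiffusiveBondHeat.ThoulessBudgetLadder`, critic rows 655/656/662).  Assignment (row 655): the T₁ memo —
what makes `V_N(b,cN²) ≤ A·N` plausible; which bond `b`, which `c`; the Ohm-free slope `4γT²E_N` of H1 against the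
needed `A`; an instrument for the census.

THESIS.  Write `θ₀ := p₀² − T` (the bath-site kinetic fluctuation), `P_u` := `transitionKernel N T T u`, `μ_T` :=
`gibbsMeasure N T`, `K_N(u) := ⟨θ₀, P_u θ₀⟩_{μ_T}` (the boundary kernel of the tree), `E_N := 1 − (γ/T²)∫₀^∞ K_N`
(escape deficit; `ContactOhmicFloor` ⟺ 11071 says `E_N ≤ C₁/N`), `τ_N(s) := (1 − (γ/T²)∫₀ˢK_N) − E_N = (γ/T²)∫ₛ^∞ K_N`
(the Ohm-free transient, `pinnedChain_deficit_transient_eq`).  TB at the bath bond splits EXACTLY (landed bath-bond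
reduction `stub_bathBondReduction_of_kernelFacts` + `localEnergyMoment`) as

  `V_N(0,t) ≤ 4γT²·(t·E_N + ∫₀ᵗ τ_N) + 8σ²`,                                                    (†)

so `TB ⟸ ContactOhmicFloor ∧ TransientBudget`, where `TransientBudget` (T₁^∀) := `∃ C N₀ ∀ N ≥ N₀ ∀ t ≥ 0, ∫₀ᵗ τ_N ≤ C·N`
is the `N`-UNIFORM version of the landed fixed-`N` theorem `pinnedChain_transientIntegral_le_fixedN` (`∃ B_N ∀ t, ∫₀ᵗτ_N ≤ B_N`).
The new object is the BOUNDARY KINETIC CORRECTOR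

  `g_N^τ(z) := ∫₀^τ (P_u θ₀)(z) du`     (`τ → ∞`: `g_N = (−L)⁻¹θ₀`, the Poisson corrector of the bath-site kinetic energy),

and the reduction of this node is

  T₁^∀ ⟸ `KineticCorrectorBudget` (KCB: `∃ C N₀ ∀ N ≥ N₀ ∀ τ ≥ 0, ‖g_N^τ‖²_{L²(μ_T)} ≤ C·N`)
        ∧ `CorrectorDominatesTransient` (TCI, fixed `N`: `(∀ τ, ‖g_N^τ‖² ≤ M) → ∀ t, ∫₀ᵗ τ_N ≤ (γ/T²)·M`).

WHY TCI IS A FIXED-`N` IDENTITY (support, ATTACKABLE; not proved here — it needs Chapman–Kolmogorov for `transitionKernel`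
and the momentum-flip symmetry, both one level below the tree's `stub_kernelDetailedBalance`):  with `Θ(q,p) = (q,−p)`,
`Θθ₀ = θ₀` and kernel detailed balance `⟨f, P_s h⟩ = ⟨Θh, P_s Θf⟩`,
  `⟨Θ g^t, g^τ⟩ = ∫₀ᵗ∫₀^τ ⟨ΘP_uθ₀, P_vθ₀⟩ dv du = ∫₀ᵗ∫₀^τ K_N(u+v) dv du = ∫₀^{t+τ} w_{t,τ}(u) K_N(u) du`,
  `w_{t,τ}(u) = min(u,t) − max(0,u−τ) ↑ min(u,t)` as `τ → ∞` (`K_N ∈ L¹`, landed `BoundaryKernelDecay`), while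
  `∫₀ᵗ τ_N = (γ/T²)∫₀^∞ min(u,t) K_N(u) du` (Fubini on `τ_N(s) = (γ/T²)∫ₛ^∞K_N`).  Hence
  `∫₀ᵗ τ_N = (γ/T²) lim_τ ⟨Θg^t, g^τ⟩ ≤ (γ/T²) sup_τ ‖g^t‖‖g^τ‖ ≤ (γ/T²)·M`  (Cauchy–Schwarz, `Θ` is `μ_T`-unitary).

WHY KCB IS THE RIGHT LEAF (dictionary; all identities exact for the harmonic member and formal in general):
* sum rule `g_N^0 + g_N^{N−1} = (H − ⟨H⟩)/γ` (since `L H = γ(2T − p₀² − p_{N−1}²)`); antisymmetric part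
  `a_N := ½(g^0 − g^{N−1}) = ½(−L)⁻¹(θ₀ − θ_{N−1})`; by reflection `‖g^0‖² = Var_T(H)/(4γ²) + ‖a_N‖²`, `Var_T(H) = O(N)`:
  KCB ⟺ `‖a_N‖² ≤ C·N`.
* `⟨θ₀, a_N⟩ = (T²/γ)(½ − E_N)`: the Ohmic floor (11071) is a LOWER bound on ONE linear functional of `a_N`
  (the Dirichlet-principle side); KCB is an UPPER bound on its whole norm (the Thomson side).  They are logically
  independent a priori — (†) needs both.
* (K) = 9121 `ExtensiveSnapshotIrreversibility` has `K_N^{(9121)} = (2γ²/T⁴)‖a_N^{odd}‖²` (odd part under `Θ`), so the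
  `N`-uniform content of (K) is EXACTLY the odd half of KCB; the even half `‖a_N^{even}‖² ≤ CN` is the local-equilibrium
  statement `a^{even} ≈ (1/2γ)Σ_x(1 − 2x/N)·δe_x`, `‖·‖² ≈ χN/(12γ²)` for a diffusive chain.
* linear response of the NESS in the temperature DIFFERENCE: `∂_{δT} ρ|_{eq} = (γ/T²)(Θ a_N)ρ_T`, so KCB ⟺ the Fisher
  information of `ρ_{T+δ,T−δ}` at `δ = 0` is `≤ C·N` (Cramér–Rao reading: the chain cannot resolve `δT` better than
  `N^{-1/2}`); this is the equilibrium avatar of the moot `LiouvilleLadder.TopScaleBound` (stmt-4430).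
HARMONIC SEPARATION (lam = β = 0 analogue; exact Gaussian algebra, `numerics/harmonic_corrector_pure.py`, identities
checked to 1e-13): `g^0 = zᵀM⁰z − tr(M⁰Σ)` with `AᵀM⁰ + M⁰A = −Π₀`, `‖g^0‖² = 2tr((M⁰Σ)²) ≤ Var(H)/(2γ²) = T²N/(2γ²)`
(PROVED for the Gaussian member via `⟨g^0,g^{N−1}⟩ = 2tr(M⁰ΣM^{N−1}Σ) ≥ 0`); measured at `ω₂ = γ = T = 1`, `N = 2…32`:
`‖g^0‖²/N → 0.340`, `⟨g^0,g^{N−1}⟩/N → +0.160`, `‖a‖²/N → 0.090` (odd `0.080·N`, even `→ 0.33 = O(1)`),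
`K^{(9121)}_N/N → 0.160` (= the route's own Numbers `K_N ≈ 0.16N` — dictionary confirmed), `E_N → 1/8`, `G_N = γE_N`
exactly, `sup_t ∫₀ᵗτ_N /N = (γ/T²)∫uK_N/N → 0.180 ≤ (γ/T²)‖g^0‖²/N` (TCI respected).  So KCB and T₁^∀ HOLD for phonons
while TB FAILS for phonons (`G_N → G_∞ > 0`, `HarmonicChainBallisticFlux_holds`; `V_N(0,cN²) ≥ (√(2T²G_N c)·N − 2‖h₀‖)²`,
`‖h₀‖² ≈ 0.31N`): KCB is STRICTLY WEAKER than TB, Ohm-free and EW-free (the route's `stub_transientEW` is FALSE for phonons —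
`∫₀ᵗτ_N` saturates at `0.18N` instead of growing like `√t` — T₁^∀ is its true, phonon-compatible replacement).

ANSWERS (row 655).  WHICH BOND: immaterial at `O(N)` — `V_N(b,t) ≤ 2V_N(0,t) + 8Var_T(E_{≤b})`, `Var_T(E_{≤b}) = O(b)`;
take `b = 0` where (†) is landed.  WHICH c: any; `c` only trades against the Ohmic constant, `A(c) = 4γT²(c·C₁⁺ + C_{T₁}⁺) + 8σ²`
(seam 2 takes `c = 1`).  SLOPE: H1's Ohm-free slope `4γT²E_N` is `2×` the Ohmic slope `2T²G_N` (`G_N = γE_N`, checked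
exactly in the harmonic member); TB needs `E_N ≤ A/(4γT²cN)`, i.e. EXACTLY the floor 11071 — the slope side of TB carries no
content beyond the residual; ALL the surplus is T₁^∀ ⟸ KCB.  VERDICT: TB is not an independent attack target this week —
its surplus over 11071 is an `N`-uniform corrector (local-equilibrium / Fisher-information) budget whose odd half is (K)
and whose proof needs the same missing input as BoundedResponse (an `N`-uniform sensitivity / gradient bound on `(−L)⁻¹θ₀`,
e.g. `∫|∇_p g_N|²e^{−H/T} ≤ CN`, cf. the closing-gap barrier `SpectralGapClosing`: resolvent bounds give `N⁴`).  The ladder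
stands as a map; the corrector dictionary (TB − 11071 = KCB ⊇ (K)^{unif}) is the new edge.

INSTRUMENT (census LOW, no kit here): (i) harmonic calibration = this file's numerics (done); (ii) anharmonic two-replica
estimator of `‖a_N^{t_max}‖²`: draw `z ~ μ_T` (one equilibrated trajectory), run TWO independent-noise copies from `z`,
`F_i := ½∫₀^{t_max}(p₀² − p_{N−1}²)dt`, then `E[F₁F₂] = ‖a_N^{t_max}‖²` exactly (DC-free by antisymmetry; no `N²`-long
variance subtraction); `N = 16…128`, `t_max = 5N²/D`; prediction plateau `‖a‖²/N → χ/(12γ²) + O(1)`; growth in `N` of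
`‖a‖²/N` kills KCB and with it T₁^∀ and TB (but not 11071).

TAGS.  `KineticCorrectorBudget`: WEAKER (harmonic separation above) · INSTRUMENTABLE (ii) · IDEA-NEEDED (no `N`-uniform
sensitivity bound in the tree; natural tools: Gaussian Brascamp–Lieb for the `p`-gradient, Kipnis–Varadhan/`H₋₁` norm of
`θ₀ − θ_{N−1}`, Bernardin–Olla-type corrector bounds for the an-harmonic chain with conservative noise — none applies verbatim
to the deterministic bulk).  `CorrectorDominatesTransient`: support, ATTACKABLE (fixed-`N`, M-sized: CK + flip symmetry +
Fubini/DCT).  `TransientBudget`: UNDECIDED rung (T₁^∀), WEAKER than TB by the same phonon witness.  `ContactOhmicFloor`: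
COSTUME of the residual 11071 (landed `boundedResponse_iff_ohmicFloor`), imported, not attacked.
Seams (sorry-free): `transientBudget_of_kcb`, `thoulessBudget_of_transientBudget_of_ohmicFloor`, `thoulessBudget_of_kcb`,
`thoulessBudget_of_kcb_of_boundedResponse`, `thoulessBudget_iff_boundedResponse_of_kcb`, `fouriersLaw_of_kcb`.
No item is closed here.
-/

noncomputable section

open MeasureTheory Filter Topology Set
open Literature.MathematicalPhysics.KineticTheory.HeatConduction

namespace Summit.AtomisticToContinuum.FouriersLaw.Theorems.SubdiffusiveBondHeat.CorrectorBudget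

open Summit.AtomisticToContinuum.FouriersLaw.Theses.BondHeatUncertainty
  (SubdiffusiveBondHeat ExtensiveSnapshotIrreversibility BoundedResponse)
open Summit.AtomisticToContinuum.FouriersLaw.Theorems.SubdiffusiveBondHeat.ThoulessBudgetLadder
  (ThoulessBudget LateBudget ContactOhmicFloor FixedNAffineBathBondCeiling
   boundedResponse_of_thoulessBudget_of_snapshot fouriersLaw_of_thoulessBudget)

/-! ## The three statements -/

/-- **KCB — kinetic-corrector budget** (crux of this node, rank 2; WEAKER than TB, INSTRUMENTABLE, IDEA-NEEDED).
`∃ C N₀ ∀ N ≥ N₀ ∀ τ ≥ 0, ‖g_N^τ‖²_{L²(μ_T)} ≤ C·N` with `g_N^τ(z) = ∫₀^τ (P_uθ₀)(z)du`, `θ₀ = p₀² − T`.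
Why it might fail: super-diffusive an-harmonic transport with a NON-local-equilibrium corrector (‖a_N‖² ≫ N) — no known
witness in the pinned, momentum-non-conserving class; phonons satisfy it (`≤ T²N/(2γ²)`). [piece · crux · instrument] -/
def KineticCorrectorBudget : Prop :=
  ∀ ω₂ lam β γ : ℝ, 0 < ω₂ → 0 < lam → 0 < β → 0 < γ → ∀ T : ℝ, 0 < T →
    ∃ C : ℝ, ∃ N₀ : ℕ, ∀ N : ℕ, N₀ ≤ N → ∀ τ : ℝ, 0 ≤ τ →
      (if h : 0 < N then
        ∫ z, (∫ u in (0 : ℝ)..τ, ∫ y, ((y.2 ⟨0, h⟩) ^ 2 - T)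
            ∂((pinnedChain ω₂ lam β γ).transitionKernel N T T u.toNNReal z)) ^ 2
          ∂((pinnedChain ω₂ lam β γ).gibbsMeasure N T)
       else 0) ≤ C * (N : ℝ)

/-- **TCI — the corrector dominates the once-integrated transient** (support, fixed `N`, ATTACKABLE):
`(∀ τ ≥ 0, ‖g_N^τ‖² ≤ M) → ∀ t ≥ 0, ∫₀ᵗ τ_N(s) ds ≤ (γ/T²)·M`, from the identity
`∫₀ᵗ τ_N = (γ/T²) lim_τ ⟨Θg_N^t, g_N^τ⟩` (kernel detailed balance + Chapman–Kolmogorov + `K_N ∈ L¹`) and Cauchy–Schwarz.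
[piece · support] -/
def CorrectorDominatesTransient : Prop :=
  ∀ ω₂ lam β γ : ℝ, 0 < ω₂ → 0 < lam → 0 < β → 0 < γ → ∀ T : ℝ, 0 < T → ∀ (N : ℕ) (hN : 1 < N) (M : ℝ),
    (∀ τ : ℝ, 0 ≤ τ →
      ∫ z, (∫ u in (0 : ℝ)..τ, ∫ y, ((y.2 ⟨0, Nat.zero_lt_of_lt hN⟩) ^ 2 - T)
          ∂((pinnedChain ω₂ lam β γ).transitionKernel N T T u.toNNReal z)) ^ 2
        ∂((pinnedChain ω₂ lam β γ).gibbsMeasure N T) ≤ M) →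
    ∀ t : ℝ, 0 ≤ t →
      (∫ s in (0 : ℝ)..t,
        ((1 - γ / T ^ 2 * ∫ u in (0 : ℝ)..s,
            ∫ z, ((z.2 ⟨0, Nat.zero_lt_of_lt hN⟩) ^ 2 - T) *
                (∫ y, ((y.2 ⟨0, Nat.zero_lt_of_lt hN⟩) ^ 2 - T)
                  ∂((pinnedChain ω₂ lam β γ).transitionKernel N T T u.toNNReal z))
              ∂((pinnedChain ω₂ lam β γ).gibbsMeasure N T)) -
          (1 - γ / T ^ 2 * ∫ u in Set.Ioi (0 : ℝ),
            ∫ z, ((z.2 ⟨0, Nat.zero_lt_of_lt hN⟩) ^ 2 - T) *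
                (∫ y, ((y.2 ⟨0, Nat.zero_lt_of_lt hN⟩) ^ 2 - T)
                  ∂((pinnedChain ω₂ lam β γ).transitionKernel N T T u.toNNReal z))
              ∂((pinnedChain ω₂ lam β γ).gibbsMeasure N T)))) ≤ γ / T ^ 2 * M

/-- **T₁^∀ — the `N`-uniform transient budget** (rung; UNDECIDED, WEAKER than TB): `∃ C N₀ ∀ N ≥ N₀ ∀ t ≥ 0,
∫₀ᵗ (1 − θ_N(s) − E_N) ds ≤ C·N` — the `N`-uniformity, linear in `N` and uniform in `t`, of the landed fixed-`N` bound
`pinnedChain_transientIntegral_le_fixedN` (same spelling).  Why it might fail: as KCB. [piece · rung] -/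
def TransientBudget : Prop :=
  ∀ ω₂ lam β γ : ℝ, 0 < ω₂ → 0 < lam → 0 < β → 0 < γ → ∀ T : ℝ, 0 < T →
    ∃ C : ℝ, ∃ N₀ : ℕ, ∀ N : ℕ, N₀ ≤ N → ∀ t : ℝ, 0 ≤ t →
      (∫ s in (0 : ℝ)..t,
        (1 - γ / T ^ 2 * (∫ u in (0 : ℝ)..s,
            if h : 0 < N then
              ∫ z, ((z.2 ⟨0, h⟩) ^ 2 - T) *
                  (∫ y, ((y.2 ⟨0, h⟩) ^ 2 - T) ∂((pinnedChain ω₂ lam β γ).transitionKernel N T T u.toNNReal z))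
                ∂((pinnedChain ω₂ lam β γ).gibbsMeasure N T)
            else 0) -
          (1 - γ / T ^ 2 * (∫ u in Set.Ioi (0 : ℝ),
            if h : 0 < N then
              ∫ z, ((z.2 ⟨0, h⟩) ^ 2 - T) *
                  (∫ y, ((y.2 ⟨0, h⟩) ^ 2 - T) ∂((pinnedChain ω₂ lam β γ).transitionKernel N T T u.toNNReal z))
                ∂((pinnedChain ω₂ lam β γ).gibbsMeasure N T)
            else 0)))) ≤ C * (N : ℝ)

/-! ## Seam 1: KCB ∧ TCI ⟹ T₁^∀ -/

/-- **KCB → TCI → TransientBudget** with `C_{T₁} = (γ/T²)·C_{KCB}`, `N₀ ↦ max N₀ 2`. [folklore] -/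
theorem transientBudget_of_kcb :
    KineticCorrectorBudget → CorrectorDominatesTransient → TransientBudget := by
  intro hK hD ω₂ lam β γ hω hl hβ hγ T hT
  obtain ⟨C, N₀, hC⟩ := hK ω₂ lam β γ hω hl hβ hγ T hT
  refine ⟨γ / T ^ 2 * C, max N₀ 2, fun N hN t ht => ?_⟩
  have hN₀ : N₀ ≤ N := le_trans (le_max_left _ _) hN
  have hN2 : 2 ≤ N := le_trans (le_max_right _ _) hN
  have hN1 : 1 < N := by omega
  have hM : ∀ τ : ℝ, 0 ≤ τ →
      ∫ z, (∫ u in (0 : ℝ)..τ, ∫ y, ((y.2 ⟨0, Nat.zero_lt_of_lt hN1⟩) ^ 2 - T)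
          ∂((pinnedChain ω₂ lam β γ).transitionKernel N T T u.toNNReal z)) ^ 2
        ∂((pinnedChain ω₂ lam β γ).gibbsMeasure N T) ≤ C * (N : ℝ) := by
    intro τ hτ
    have h := hC N hN₀ τ hτ
    simp only [dif_pos (Nat.zero_lt_of_lt hN1)] at h
    exact h
  have key := hD ω₂ lam β γ hω hl hβ hγ T hT N hN1 (C * (N : ℝ)) hM t ht
  simp only [dif_pos (Nat.zero_lt_of_lt hN1)]
  calc _ ≤ _ := key
    _ = γ / T ^ 2 * C * (N : ℝ) := by ring

/-! ## Seam 2: T₁^∀ ∧ ContactOhmicFloor ⟹ TB (at the bath bond, `c = 1`) -/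

/-- **TransientBudget → ContactOhmicFloor → ThoulessBudget.**  At `b = 0`, `t = N²`: bath-bond reduction (†)
`V_N(0,t) ≤ 4γT²(∫₀ᵗτ_N + t·E_N) + 8E[e₀²]` with `∫₀ᵗτ_N ≤ C₂N`, `E_N ≤ C₁⁺/N`, `E[e₀²] ≤ σ²`:
`V_N(0,N²) ≤ (4γT²(C₂⁺ + C₁⁺) + 8σ²⁺)·N`. [folklore] -/
theorem thoulessBudget_of_transientBudget_of_ohmicFloor :
    TransientBudget → ContactOhmicFloor → ThoulessBudget := by
  intro htr hfl ω₂ lam β γ hω hl hβ hγ T hT P C V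
  obtain ⟨C₁, N₀, hflN⟩ := hfl ω₂ lam β γ hω hl hβ hγ T hT
  obtain ⟨C₂, N₀', htrN⟩ := htr ω₂ lam β γ hω hl hβ hγ T hT
  obtain ⟨σ2, hσ⟩ := localEnergyMoment ω₂ lam β γ hω hl hβ hγ T hT
  refine ⟨4 * γ * T ^ 2 * (max C₂ 0 + max C₁ 0) + 8 * max σ2 0, 1, one_pos, max (max N₀ N₀') 2, fun N hN => ?_⟩
  have hN₀ : N₀ ≤ N := le_trans (le_trans (le_max_left _ _) (le_max_left _ _)) hN
  have hN₀' : N₀' ≤ N := le_trans (le_trans (le_max_right _ _) (le_max_left _ _)) hN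
  have hN2 : 2 ≤ N := le_trans (le_max_right _ _) hN
  have hN1 : 1 < N := by omega
  have hNpos : (0 : ℝ) < N := by exact_mod_cast (show 0 < N by omega)
  have hN1r : (1 : ℝ) ≤ N := by exact_mod_cast (show 1 ≤ N by omega)
  refine ⟨0, by omega, ?_⟩
  simp only [V, C, dif_pos (Nat.zero_lt_of_lt hN1)]
  set t : ℝ := 1 * (N : ℝ) ^ 2 with ht
  have ht0 : 0 ≤ t := by positivity
  -- the landed bath-bond reduction (†) and the uniform statics
  have hred := stub_bathBondReduction_of_kernelFacts ω₂ lam β γ hω hl hβ hγ T hT N hN1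
    (stub_kernelDetailedBalance ω₂ lam β γ hω hl hβ hγ T hT N hN1)
    (stub_siteEnergyDynkin ω₂ lam β γ hω hl hβ hγ T hT N hN1)
    (stub_siteEnergyCurrentCovariance ω₂ lam β γ hω hl hβ hγ T hT N hN1) t ht0
  have hmom := hσ N hN1
  -- the N-uniform transient budget and the Ohmic floor, in H1's spelling
  have htrt := htrN N hN₀' t ht0
  simp only [dif_pos (Nat.zero_lt_of_lt hN1)] at htrt
  have hE : 1 - γ / T ^ 2 * (∫ u in Set.Ioi (0 : ℝ),
      ∫ z, ((z.2 ⟨0, Nat.zero_lt_of_lt hN1⟩) ^ 2 - T) *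
          (∫ y, ((y.2 ⟨0, Nat.zero_lt_of_lt hN1⟩) ^ 2 - T)
            ∂((pinnedChain ω₂ lam β γ).transitionKernel N T T u.toNNReal z))
        ∂((pinnedChain ω₂ lam β γ).gibbsMeasure N T)) ≤ max C₁ 0 / (N : ℝ) := by
    have h := hflN N hN₀
    simp only [dif_pos (Nat.zero_lt_of_lt hN1)] at h
    exact h.trans (div_le_div_of_nonneg_right (le_max_left _ _) hNpos.le)
  have hθc := pinnedChain_continuous_stepResponse hω hl hβ hγ hT (Nat.zero_lt_of_lt hN1)
  -- name the boundary kernel and the escape deficit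
  set K : ℝ → ℝ := fun u => ∫ z, ((z.2 ⟨0, Nat.zero_lt_of_lt hN1⟩) ^ 2 - T) *
      (∫ y, ((y.2 ⟨0, Nat.zero_lt_of_lt hN1⟩) ^ 2 - T)
        ∂((pinnedChain ω₂ lam β γ).transitionKernel N T T u.toNNReal z))
    ∂((pinnedChain ω₂ lam β γ).gibbsMeasure N T) with hK
  set E : ℝ := 1 - γ / T ^ 2 * ∫ u in Set.Ioi (0 : ℝ), K u with hE'
  -- W_N(t) = ∫₀ᵗ τ_N + t·E_N
  have hfi : IntervalIntegrable (fun s : ℝ => 1 - γ / T ^ 2 * ∫ u in (0 : ℝ)..s, K u) volume 0 t :=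
    (continuous_const.sub hθc).intervalIntegrable 0 t
  have hW : ∫ s in (0 : ℝ)..t, (1 - γ / T ^ 2 * ∫ u in (0 : ℝ)..s, K u) =
      (∫ s in (0 : ℝ)..t, ((1 - γ / T ^ 2 * ∫ u in (0 : ℝ)..s, K u) - E)) + t * E := by
    rw [intervalIntegral.integral_sub hfi intervalIntegrable_const, intervalIntegral.integral_const, smul_eq_mul,
      sub_zero]
    ring
  -- t·E_N ≤ N²·C₁⁺/N = C₁⁺·N and ∫₀ᵗ τ_N ≤ C₂ N ≤ C₂⁺ N
  have htE : t * E ≤ max C₁ 0 * (N : ℝ) := by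
    have h1 : t * E ≤ t * (max C₁ 0 / (N : ℝ)) := mul_le_mul_of_nonneg_left hE ht0
    have h2 : t * (max C₁ 0 / (N : ℝ)) = max C₁ 0 * (N : ℝ) := by
      rw [ht]; field_simp
    linarith
  have htr' : ∫ s in (0 : ℝ)..t, ((1 - γ / T ^ 2 * ∫ u in (0 : ℝ)..s, K u) - E) ≤ max C₂ 0 * (N : ℝ) :=
    htrt.trans (mul_le_mul_of_nonneg_right (le_max_left _ _) hNpos.le)
  have hWle : ∫ s in (0 : ℝ)..t, (1 - γ / T ^ 2 * ∫ u in (0 : ℝ)..s, K u) ≤ (max C₂ 0 + max C₁ 0) * (N : ℝ) := by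
    rw [hW]; linarith
  have hσ' : σ2 ≤ max σ2 0 * (N : ℝ) :=
    (le_max_left σ2 0).trans (le_mul_of_one_le_right (le_max_right _ _) hN1r)
  have hγT : 0 ≤ 4 * γ * T ^ 2 := by positivity
  calc _ ≤ _ := hred
    _ ≤ 4 * γ * T ^ 2 * ((max C₂ 0 + max C₁ 0) * (N : ℝ)) + 8 * (max σ2 0 * (N : ℝ)) := by
        nlinarith [mul_le_mul_of_nonneg_left hWle hγT]
    _ = (4 * γ * T ^ 2 * (max C₂ 0 + max C₁ 0) + 8 * max σ2 0) * (N : ℝ) := by ring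

/-! ## Seam 3: corollaries by name -/

/-- **KCB → TCI → ContactOhmicFloor → TB**: the Thouless budget from the residual's Ohmic floor plus the corrector budget.
[folklore] -/
theorem thoulessBudget_of_kcb (hK : KineticCorrectorBudget) (hD : CorrectorDominatesTransient)
    (hfl : ContactOhmicFloor) : ThoulessBudget :=
  thoulessBudget_of_transientBudget_of_ohmicFloor (transientBudget_of_kcb hK hD) hfl

/-- **KCB → TCI → BoundedResponse → TB** (the floor by the landed `ohmicFloor_of_boundedResponse`). [folklore] -/
theorem thoulessBudget_of_kcb_of_boundedResponse (hK : KineticCorrectorBudget) (hD : CorrectorDominatesTransient)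
    (hB : BoundedResponse) : ThoulessBudget :=
  thoulessBudget_of_kcb hK hD (ohmicFloor_of_boundedResponse hB)

/-- **Modulo KCB ∧ TCI (and (K) left-to-right), TB IS the residual**: `(K) → KCB → TCI → (ThoulessBudget ↔ BoundedResponse)`.
With g52's `lateBudget_iff_boundedResponse` this says: the whole surplus of TB over the floor LB ⟺_(K) 11071 is the
corrector budget KCB (given the fixed-`N` identity TCI). [folklore] -/
theorem thoulessBudget_iff_boundedResponse_of_kcb (hK9121 : ExtensiveSnapshotIrreversibility)
    (hK : KineticCorrectorBudget) (hD : CorrectorDominatesTransient) : ThoulessBudget ↔ BoundedResponse :=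
  ⟨fun hTB => boundedResponse_of_thoulessBudget_of_snapshot hTB hK9121,
   thoulessBudget_of_kcb_of_boundedResponse hK hD⟩

/-- KCB is ON the FouriersLaw cone only THROUGH the residual: `KCB → TCI → ContactOhmicFloor → (K) → 24580 → 24581 →
FouriersLaw` (by g52's `fouriersLaw_of_thoulessBudget`; the Ohmic floor — i.e. 11071 — remains load-bearing). [folklore] -/
theorem fouriersLaw_of_kcb (hK : KineticCorrectorBudget) (hD : CorrectorDominatesTransient) (hfl : ContactOhmicFloor)
    (hK9121 : ExtensiveSnapshotIrreversibility)
    (hLim : Summit.AtomisticToContinuum.FouriersLaw.Theses.ResponseFloorAndLimit.ResponseLimitExists)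
    (hPos : Summit.AtomisticToContinuum.FouriersLaw.Theses.ResponseFloorAndLimit.ResponseEventuallyPositive) :
    _root_.FouriersLaw :=
  fouriersLaw_of_thoulessBudget (thoulessBudget_of_kcb hK hD hfl) hK9121 hLim hPos

end Summit.AtomisticToContinuum.FouriersLaw.Theorems.SubdiffusiveBondHeat.CorrectorBudget

end
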